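import Summits.CriticalPhenomena.PercolationContinuityZ3.Theorems.PercNearOneGluingNoHeavyLowerTailTwoPortPeelingStarSlice
import Summits.CriticalPhenomena.PercolationContinuityZ3.Theorems.PercNearOneGluingNoHeavyLowerTailTwoPortPeeling
import HarnessLib

/-!
# `NoHeavyLowerTail` (stmt-CriticalPhenomena-4575) — MS-STAR for two two-port stars: the assembly (memo TWO-PORT-PEELING.md §5)

Route `PercNearOneGluingNoHeavy`, seat `prim-gen-swap` (gen 5).  For two new two-port star vertices `u` (ports `a ≠ a'`) and `v` (ports `b ≠ b'`),
all four ports distinct, and a champion `c ∉ {a,a',b,b'}`: CS₂(u,v;c) — `c` is a valid cumulative-isolation witness for the merged star — follows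
from ONE explicit inequality E∅∅ (the "both stars comonotone" merge stability, certified by exact computation at (|A|,j) ∈
{(5,2),(6,2),(6,3),(7,2),(8,2)}, kit j054427), in the range `j ≤ 2 ∨ |A| ≤ j+3`.  Chain: two-port reduction on `v`
(`championStabilityPair_twoPort_of_mixed`) + the same four-slice algebra on `u` + `erel_slice_nonneg` (twice, `…StarSlice.lean`).
No definitions, no named facts, no sorries.
-/

noncomputable section

namespace Summit.CriticalPhenomena.PercolationContinuityZ3.Theorems

open MeasureTheory Set Literature.Probability.LatticeModels Literature.Probability.Percolation
open scoped Classical BigOperators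

variable {n : ℕ}

open TwoPortPeeling in
/-- **MS-STAR for two two-port stars, from the comonotone inequality E∅∅ (memo §5).**  For bond percolation with arbitrary edge
probabilities on `Fin n`, relays `A`, a level `j` with `j ≤ 2 ∨ |A| ≤ j+3`, two distinct non-relay vertices `u, v` that are two-port stars with
ports `{a,a'}`, `{b,b'}` (four distinct relays; all other pairs at `u`, `v` of weight `0`) and a champion `c ∉ {b,b'}` of `w`: IF the single
inequality E∅∅ holds — `(1 − θ_u)·h_∅ + θ_u·h_{aa'} ≥ 0`, where `θ_u = w s(u,a)·w s(u,a')`, `θ_v = w s(v,b)·w s(v,b')` and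
`h_S = (1 − θ_v)(μ_{w₀₀,S}(|π(c)| ≤ j) − μ_{w₀₀,S}(1 ≤ |π(u)| ≤ j)) + θ_v(μ_{w₁₁,S}(ρ) − μ_{w₁₁,S}(ℓ))` is the value of the `u`-slice `S`
(`w₀₀ = w[vb↦0][vb'↦0]`, `w₁₁ = w[vb↦1][vb'↦1]`, then `u`'s two ports pinned according to `S ∈ {∅, aa'}`; `ρ, ℓ` the CS₂ pair events) —
THEN `μ_w(c ↮ u, c ↮ v, 1 ≤ |π(u) ∪ π(v)| ≤ j) ≤ μ_w(c ↮ u, c ↮ v, |π(c)| ≤ j)` (CS₂, i.e. `c` is a valid cumulative-isolation witness for the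
merged star).  E∅∅ is "merge stability for two comonotone two-port stars"; it is certified by exact computation at
`(|A|,j) ∈ {(5,2),(6,2),(6,3),(7,2),(8,2)}` (pointwise certificate `θ_u K_a + θ_v(1−θ_u) K_b`, memo §5 (P2), kit j054427) and is the only non-formal
input of the (5,2) double-switch theorem.  Proof: `championStabilityPair_twoPort_of_mixed` (peel `v`), the four-slice split over `u`'s ports
(`real_twoBond`), `erel_slice_nonneg` for `a` and for `a'`, and `Ψ ≥ (1−θ_u)·min + θ_u·h_{aa'}`.
[cite: VandenbergHaggstromKahn2005, Thm. 1.5 (p. 7) — via the two-port reduction] -/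
theorem championStabilityPair_twoStars_of_comonotone (w : Sym2 (Fin n) → unitInterval) (A : Finset (Fin n))
    (u v a a' b b' c : Fin n) (j : ℕ) (hu : u ∉ A) (hv : v ∉ A) (huv : u ≠ v)
    (ha : a ∈ A) (ha' : a' ∈ A) (hb : b ∈ A) (hb' : b' ∈ A) (hc : c ∈ A)
    (haa' : a ≠ a') (hbb' : b ≠ b') (hab : a ≠ b) (hab' : a ≠ b') (ha'b : a' ≠ b) (ha'b' : a' ≠ b')
    (hcb : c ≠ b) (hcb' : c ≠ b')
    (hutwo : ∀ y : Fin n, y ≠ u → y ≠ a → y ≠ a' → w s(u, y) = 0)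
    (hvtwo : ∀ y : Fin n, y ≠ v → y ≠ b → y ≠ b' → w s(v, y) = 0)
    (hreg : j ≤ 2 ∨ A.card ≤ j + 3)
    (hchamp : ∀ x ∈ A,
      (prodBernoulli w).real {ω : BondConfig (Fin n) | (A.filter fun z => ω ∈ openConn x z).card ≤ j} ≤
        (prodBernoulli w).real {ω : BondConfig (Fin n) | (A.filter fun z => ω ∈ openConn c z).card ≤ j})
    (hE00 : 0 ≤ (1 - ((w s(u, a) : ℝ) * w s(u, a'))) * ((1 - ((w s(v, b) : ℝ) * w s(v, b'))) * ((prodBernoulli (Function.update (Function.update (Function.update (Function.update w s(v, b) 0) s(v, b') 0) s(u, a) 0) s(u, a') 0)).real {ω : BondConfig (Fin n) | (A.filter fun z => ω ∈ openConn c z).card ≤ j} - (prodBernoulli (Function.update (Function.update (Function.update (Function.update w s(v, b) 0) s(v, b') 0) s(u, a) 0) s(u, a') 0)).real {ω : BondConfig (Fin n) | 1 ≤ (A.filter fun z => ω ∈ openConn u z).card ∧ (A.filter fun z => ω ∈ openConn u z).card ≤ j}) + ((w s(v, b) : ℝ) * w s(v, b')) * ((prodBernoulli (Function.update (Function.update (Function.update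 (Function.update w s(v, b) 1) s(v, b') 1) s(u, a) 0) s(u, a') 0)).real {ω : BondConfig (Fin n) | ω ∉ openConn c u ∧ ω ∉ openConn c v ∧ (A.filter fun z => ω ∈ openConn c z).card ≤ j} - (prodBernoulli (Function.update (Function.update (Function.update (Function.update w s(v, b) 1) s(v, b') 1) s(u, a) 0) s(u, a') 0)).real {ω : BondConfig (Fin n) | ω ∉ openConn c u ∧ ω ∉ openConn c v ∧ 1 ≤ (A.filter fun z => ω ∈ openConn u z ∨ ω ∈ openConn v z).card ∧ (A.filter fun z => ω ∈ openConn u z ∨ ω ∈ openConn v z).card ≤ j})) +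
      ((w s(u, a) : ℝ) * w s(u, a')) * ((1 - ((w s(v, b) : ℝ) * w s(v, b'))) * ((prodBernoulli (Function.update (Function.update (Function.update (Function.update w s(v, b) 0) s(v, b') 0) s(u, a) 1) s(u, a') 1)).real {ω : BondConfig (Fin n) | (A.filter fun z => ω ∈ openConn c z).card ≤ j} - (prodBernoulli (Function.update (Function.update (Function.update (Function.update w s(v, b) 0) s(v, b') 0) s(u, a) 1) s(u, a') 1)).real {ω : BondConfig (Fin n) | 1 ≤ (A.filter fun z => ω ∈ openConn u z).card ∧ (A.filter fun z => ω ∈ openConn u z).card ≤ j}) + ((w s(v, b) : ℝ) * w s(v, b')) * ((prodBernoulli (Function.update (Function.update (Function.update (Function.update w s(v, b) 1) s(v, b') 1) s(u, a) 1) s(u, a') 1)).real {ω : BondConfig (Fin n) | ω ∉ openConn c u ∧ ω ∉ openConn c v ∧ (A.filter fun z => ω ∈ openConn c z).card ≤ j} - (prodBernoulli (Function.update (Function.update (Function.update (Function.update w s(v, b) 1) s(v, b') 1) s(u, a) 1) s(u, a') 1)).real {ω : BondConfig (Fin n) | ω ∉ openConn c u ∧ ω ∉ openConn c v ∧ 1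 ≤ (A.filter fun z => ω ∈ openConn u z ∨ ω ∈ openConn v z).card ∧ (A.filter fun z => ω ∈ openConn u z ∨ ω ∈ openConn v z).card ≤ j}))) :
    (prodBernoulli w).real {ω : BondConfig (Fin n) | ω ∉ openConn c u ∧ ω ∉ openConn c v ∧ 1 ≤ (A.filter fun z => ω ∈ openConn u z ∨ ω ∈ openConn v z).card ∧ (A.filter fun z => ω ∈ openConn u z ∨ ω ∈ openConn v z).card ≤ j} ≤
      (prodBernoulli w).real {ω : BondConfig (Fin n) | ω ∉ openConn c u ∧ ω ∉ openConn c v ∧ (A.filter fun z => ω ∈ openConn c z).card ≤ j} := by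
  have hua : u ≠ a := fun h => hu (h ▸ ha)
  have hua' : u ≠ a' := fun h => hu (h ▸ ha')
  have hub : u ≠ b := fun h => hu (h ▸ hb)
  have hub' : u ≠ b' := fun h => hu (h ▸ hb')
  have png : ∀ {p q r t : Fin n}, (p ≠ r ∨ q ≠ t) → (p ≠ t ∨ q ≠ r) → (s(p, q) : Sym2 (Fin n)) ≠ s(r, t) := by
    intro p q r t h1 h2 h
    rw [Sym2.eq_iff] at h
    rcases h with ⟨h3, h4⟩ | ⟨h3, h4⟩
    · rcases h1 with h1 | h1
      · exact h1 h3
      · exact h1 h4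
    · rcases h2 with h2 | h2
      · exact h2 h3
      · exact h2 h4
  have n_ua_ua' : (s(u, a) : Sym2 (Fin n)) ≠ s(u, a') := png (Or.inr haa') (Or.inl hua')
  have n_ua_vb : (s(u, a) : Sym2 (Fin n)) ≠ s(v, b) := png (Or.inl huv) (Or.inl hub)
  have n_ua_vb' : (s(u, a) : Sym2 (Fin n)) ≠ s(v, b') := png (Or.inl huv) (Or.inl hub')
  have n_ua'_vb : (s(u, a') : Sym2 (Fin n)) ≠ s(v, b) := png (Or.inl huv) (Or.inl hub)
  have n_ua'_vb' : (s(u, a') : Sym2 (Fin n)) ≠ s(v, b') := png (Or.inl huv) (Or.inl hub')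
  refine championStabilityPair_twoPort_of_mixed w A u v b b' c j hv hb hb' hbb' hc hvtwo hchamp ?_
  set V0 := Function.update (Function.update w s(v, b) 0) s(v, b') 0 with hV0
  set V1 := Function.update (Function.update w s(v, b) 1) s(v, b') 1 with hV1
  -- the two E_rel slices
  have Ca := erel_slice_nonneg w A u v a a' b b' c j hu hv huv ha ha' hb hb' hc haa' hbb' hab hab' ha'b hcb hcb'
    hutwo hvtwo hreg hchamp
  have hutwo' : ∀ y : Fin n, y ≠ u → y ≠ a' → y ≠ a → w s(u, y) = 0 := fun y h1 h2 h3 => hutwo y h1 h3 h2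
  have Ca' := erel_slice_nonneg w A u v a' a b b' c j hu hv huv ha' ha hb hb' hc haa'.symm hbb' ha'b ha'b' hab hcb hcb'
    hutwo' hvtwo hreg hchamp
  have hc01 : Function.update (Function.update V0 s(u, a') 1) s(u, a) 0 = Function.update (Function.update V0 s(u, a) 0) s(u, a') 1 :=
    Function.update_comm n_ua_ua'.symm _ _ _
  have hc11 : Function.update (Function.update V0 s(u, a') 1) s(u, a) 1 = Function.update (Function.update V0 s(u, a) 1) s(u, a') 1 :=
    Function.update_comm n_ua_ua'.symm _ _ _
  have hd01 : Function.update (Function.update V1 s(u, a') 1) s(u, a) 0 = Function.update (Function.update V1 s(u, a) 0) s(u, a') 1 :=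
    Function.update_comm n_ua_ua'.symm _ _ _
  have hd11 : Function.update (Function.update V1 s(u, a') 1) s(u, a) 1 = Function.update (Function.update V1 s(u, a) 1) s(u, a') 1 :=
    Function.update_comm n_ua_ua'.symm _ _ _
  have hcomm : (w s(u, a') : ℝ) * w s(u, a) = (w s(u, a) : ℝ) * w s(u, a') := mul_comm _ _
  rw [hc01, hc11, hd01, hd11, hcomm] at Ca'
  -- split the target over `u`'s two ports
  have hV0a : (V0 s(u, a) : ℝ) = w s(u, a) := by rw [hV0, Function.update_of_ne n_ua_vb', Function.update_of_ne n_ua_vb]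
  have hV0a' : (V0 s(u, a') : ℝ) = w s(u, a') := by rw [hV0, Function.update_of_ne n_ua'_vb', Function.update_of_ne n_ua'_vb]
  have hV1a : (V1 s(u, a) : ℝ) = w s(u, a) := by rw [hV1, Function.update_of_ne n_ua_vb', Function.update_of_ne n_ua_vb]
  have hV1a' : (V1 s(u, a') : ℝ) = w s(u, a') := by rw [hV1, Function.update_of_ne n_ua'_vb', Function.update_of_ne n_ua'_vb]
  rw [real_twoBond V0 n_ua_ua' {ω : BondConfig (Fin n) | (A.filter fun z => ω ∈ openConn c z).card ≤ j},
    real_twoBond V0 n_ua_ua' {ω : BondConfig (Fin n) | 1 ≤ (A.filter fun z => ω ∈ openConn u z).card ∧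
      (A.filter fun z => ω ∈ openConn u z).card ≤ j},
    real_twoBond V1 n_ua_ua' {ω : BondConfig (Fin n) | ω ∉ openConn c u ∧ ω ∉ openConn c v ∧
      (A.filter fun z => ω ∈ openConn c z).card ≤ j},
    real_twoBond V1 n_ua_ua' {ω : BondConfig (Fin n) | ω ∉ openConn c u ∧ ω ∉ openConn c v ∧
      1 ≤ (A.filter fun z => ω ∈ openConn u z ∨ ω ∈ openConn v z).card ∧
      (A.filter fun z => ω ∈ openConn u z ∨ ω ∈ openConn v z).card ≤ j},
    hV0a, hV0a', hV1a, hV1a']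
  -- names for the sixteen numbers
  set p : ℝ := (w s(u, a) : ℝ) with hp
  set q : ℝ := (w s(u, a') : ℝ) with hq
  set t : ℝ := (w s(v, b) : ℝ) * w s(v, b') with ht
  have hp0 : 0 ≤ p := (w s(u, a)).2.1
  have hp1 : p ≤ 1 := (w s(u, a)).2.2
  have hq0 : 0 ≤ q := (w s(u, a')).2.1
  have hq1 : q ≤ 1 := (w s(u, a')).2.2
  set r00 := (prodBernoulli (Function.update (Function.update V0 s(u, a) 0) s(u, a') 0)).real {ω : BondConfig (Fin n) | (A.filter fun z => ω ∈ openConn c z).card ≤ j} with hr00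
  set r10 := (prodBernoulli (Function.update (Function.update V0 s(u, a) 1) s(u, a') 0)).real {ω : BondConfig (Fin n) | (A.filter fun z => ω ∈ openConn c z).card ≤ j} with hr10
  set r01 := (prodBernoulli (Function.update (Function.update V0 s(u, a) 0) s(u, a') 1)).real {ω : BondConfig (Fin n) | (A.filter fun z => ω ∈ openConn c z).card ≤ j} with hr01
  set r11 := (prodBernoulli (Function.update (Function.update V0 s(u, a) 1) s(u, a') 1)).real {ω : BondConfig (Fin n) | (A.filter fun z => ω ∈ openConn c z).card ≤ j} with hr11
  set l00 := (prodBernoulli (Function.update (Function.update V0 s(u, a) 0) s(u, a') 0)).real {ω : BondConfig (Fin n) | 1 ≤ (A.filter fun z => ω ∈ openConn u z).card ∧ (A.filter fun z => ω ∈ openConn u z).card ≤ j} with hl00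
  set l10 := (prodBernoulli (Function.update (Function.update V0 s(u, a) 1) s(u, a') 0)).real {ω : BondConfig (Fin n) | 1 ≤ (A.filter fun z => ω ∈ openConn u z).card ∧ (A.filter fun z => ω ∈ openConn u z).card ≤ j} with hl10
  set l01 := (prodBernoulli (Function.update (Function.update V0 s(u, a) 0) s(u, a') 1)).real {ω : BondConfig (Fin n) | 1 ≤ (A.filter fun z => ω ∈ openConn u z).card ∧ (A.filter fun z => ω ∈ openConn u z).card ≤ j} with hl01
  set l11 := (prodBernoulli (Function.update (Function.update V0 s(u, a) 1) s(u, a') 1)).real {ω : BondConfig (Fin n) | 1 ≤ (A.filter fun z => ω ∈ openConn u z).card ∧ (A.filter fun z => ω ∈ openConn u z).card ≤ j} with hl11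
  set g00 := (prodBernoulli (Function.update (Function.update V1 s(u, a) 0) s(u, a') 0)).real {ω : BondConfig (Fin n) | ω ∉ openConn c u ∧ ω ∉ openConn c v ∧ (A.filter fun z => ω ∈ openConn c z).card ≤ j} with hg00
  set g10 := (prodBernoulli (Function.update (Function.update V1 s(u, a) 1) s(u, a') 0)).real {ω : BondConfig (Fin n) | ω ∉ openConn c u ∧ ω ∉ openConn c v ∧ (A.filter fun z => ω ∈ openConn c z).card ≤ j} with hg10
  set g01 := (prodBernoulli (Function.update (Function.update V1 s(u, a) 0) s(u, a') 1)).real {ω : BondConfig (Fin n) | ω ∉ openConn c u ∧ ω ∉ openConn c v ∧ (A.filter fun z => ω ∈ openConn c z).card ≤ j} with hg01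
  set g11 := (prodBernoulli (Function.update (Function.update V1 s(u, a) 1) s(u, a') 1)).real {ω : BondConfig (Fin n) | ω ∉ openConn c u ∧ ω ∉ openConn c v ∧ (A.filter fun z => ω ∈ openConn c z).card ≤ j} with hg11
  set k00 := (prodBernoulli (Function.update (Function.update V1 s(u, a) 0) s(u, a') 0)).real {ω : BondConfig (Fin n) | ω ∉ openConn c u ∧ ω ∉ openConn c v ∧ 1 ≤ (A.filter fun z => ω ∈ openConn u z ∨ ω ∈ openConn v z).card ∧ (A.filter fun z => ω ∈ openConn u z ∨ ω ∈ openConn v z).card ≤ j} with hk00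
  set k10 := (prodBernoulli (Function.update (Function.update V1 s(u, a) 1) s(u, a') 0)).real {ω : BondConfig (Fin n) | ω ∉ openConn c u ∧ ω ∉ openConn c v ∧ 1 ≤ (A.filter fun z => ω ∈ openConn u z ∨ ω ∈ openConn v z).card ∧ (A.filter fun z => ω ∈ openConn u z ∨ ω ∈ openConn v z).card ≤ j} with hk10
  set k01 := (prodBernoulli (Function.update (Function.update V1 s(u, a) 0) s(u, a') 1)).real {ω : BondConfig (Fin n) | ω ∉ openConn c u ∧ ω ∉ openConn c v ∧ 1 ≤ (A.filter fun z => ω ∈ openConn u z ∨ ω ∈ openConn v z).card ∧ (A.filter fun z => ω ∈ openConn u z ∨ ω ∈ openConn v z).card ≤ j} with hk01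
  set k11 := (prodBernoulli (Function.update (Function.update V1 s(u, a) 1) s(u, a') 1)).real {ω : BondConfig (Fin n) | ω ∉ openConn c u ∧ ω ∉ openConn c v ∧ 1 ≤ (A.filter fun z => ω ∈ openConn u z ∨ ω ∈ openConn v z).card ∧ (A.filter fun z => ω ∈ openConn u z ∨ ω ∈ openConn v z).card ≤ j} with hk11
  -- the four slice values and the min argument
  set h00 := (1 - t) * (r00 - l00) + t * (g00 - k00) with hh00
  set h10 := (1 - t) * (r10 - l10) + t * (g10 - k10) with hh10
  set h01 := (1 - t) * (r01 - l01) + t * (g01 - k01) with hh01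
  set h11 := (1 - t) * (r11 - l11) + t * (g11 - k11) with hh11
  change 0 ≤ (1 - p * q) * h00 + p * q * h11 at hE00
  change 0 ≤ (1 - p * q) * h10 + p * q * h11 at Ca
  change 0 ≤ (1 - p * q) * h01 + p * q * h11 at Ca'
  have hgoal : (1 - t) * (((1 - p) * (1 - q) * r00 + p * (1 - q) * r10 + (1 - p) * q * r01 + p * q * r11) -
        ((1 - p) * (1 - q) * l00 + p * (1 - q) * l10 + (1 - p) * q * l01 + p * q * l11)) +
      t * (((1 - p) * (1 - q) * g00 + p * (1 - q) * g10 + (1 - p) * q * g01 + p * q * g11) -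
        ((1 - p) * (1 - q) * k00 + p * (1 - q) * k10 + (1 - p) * q * k01 + p * q * k11)) =
      (1 - p) * (1 - q) * h00 + p * (1 - q) * h10 + (1 - p) * q * h01 + p * q * h11 := by
    rw [hh00, hh10, hh01, hh11]; ring
  rw [hgoal]
  set m := min (min h00 h10) h01 with hm
  have hm00 : m ≤ h00 := (min_le_left _ _).trans (min_le_left _ _)
  have hm10 : m ≤ h10 := (min_le_left _ _).trans (min_le_right _ _)
  have hm01 : m ≤ h01 := min_le_right _ _
  have hlow : 0 ≤ (1 - p * q) * m + p * q * h11 := by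
    rcases min_cases (min h00 h10) h01 with ⟨h1, -⟩ | ⟨h1, -⟩
    · rcases min_cases h00 h10 with ⟨h2, -⟩ | ⟨h2, -⟩
      · rw [hm, h1, h2]; exact hE00
      · rw [hm, h1, h2]; exact Ca
    · rw [hm, h1]; exact Ca'
  have hid : (1 - p) * (1 - q) * h00 + p * (1 - q) * h10 + (1 - p) * q * h01 + p * q * h11 -
      ((1 - p * q) * m + p * q * h11) =
      (1 - p) * (1 - q) * (h00 - m) + p * (1 - q) * (h10 - m) + (1 - p) * q * (h01 - m) := by ring
  have t1 : 0 ≤ (1 - p) * (1 - q) * (h00 - m) :=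
    mul_nonneg (mul_nonneg (sub_nonneg.2 hp1) (sub_nonneg.2 hq1)) (sub_nonneg.2 hm00)
  have t2 : 0 ≤ p * (1 - q) * (h10 - m) := mul_nonneg (mul_nonneg hp0 (sub_nonneg.2 hq1)) (sub_nonneg.2 hm10)
  have t3 : 0 ≤ (1 - p) * q * (h01 - m) := mul_nonneg (mul_nonneg (sub_nonneg.2 hp1) hq0) (sub_nonneg.2 hm01)
  linarith

end Summit.CriticalPhenomena.PercolationContinuityZ3.Theorems

end
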